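import Summits.NavierStokesRegularity.NavierStokesRegularity.Theses.AxisymmetricExtremality

/-!
# Strategist census s20-g19 — typed probes for crux `AxisymmetricKatoGlobal` (stmt-15453)

Inventory item (1): the weakest intermediate that `closes` tolerates in place of the crux.
`closes` consumes `h₃ : AxisymmetricKatoGlobal` only at the axisymmetric MINIMAL blow-up datum
produced by `h₄ (h₂ …)`; hence the threshold instance `NoAxisymMinimalBlowupDatum` (W1) is the
weakest replacement, and it is implied by the crux.  Both directions are kernel-checked below.
Nothing here restates or weakens the crux itself; these are census probes, not route items.
-/

namespace Summit.NavierStokesRegularity.NavierStokesRegularity.Cruxes.AxisymmetricKatoGlobal.StrategistS20g19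

open Summit.NavierStokesRegularity.NavierStokesRegularity.Theses.AxisymmetricExtremality
open MeasureTheory

/-- W1 (threshold instance of the crux): for every `ν > 0`, no Rusin–Šverák `Ḣ^{1/2}`-minimal
blow-up datum is axisymmetric about the `x₂`-axis (equivariance written out exactly as in the
route file). Informally: `ρ_ax(ν) > ρ_max(ν)` whenever `ρ_max(ν) < ∞` is attained. -/
def NoAxisymMinimalBlowupDatum : Prop :=
  ∀ ν : ℝ, 0 < ν → ∀ (u₀ : EuclideanSpace ℝ (Fin 3) → EuclideanSpace ℝ (Fin 3))
    (g : Literature.Analysis.FunctionSpaces.HomSobolev (EuclideanSpace ℝ (Fin 3))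
      (EuclideanSpace ℂ (Fin 3)) (1 / 2 : ℝ)),
    Literature.Analysis.FluidPDE.IsMinimalBlowupDatum ν u₀ g →
    (∀ (θ : ℝ) (x : EuclideanSpace ℝ (Fin 3)),
      u₀ (WithLp.toLp 2 ![Real.cos θ * x 0 - Real.sin θ * x 1,
        Real.sin θ * x 0 + Real.cos θ * x 1, x 2]) =
      WithLp.toLp 2 ![Real.cos θ * u₀ x 0 - Real.sin θ * u₀ x 1,
        Real.sin θ * u₀ x 0 + Real.cos θ * u₀ x 1, u₀ x 2]) → False

/-- The crux implies its threshold instance (pure logic: a minimal blow-up datum has no global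
Kato solution, the crux gives one). -/
theorem noAxisymMinimalBlowupDatum_of_crux (h : AxisymmetricKatoGlobal) :
    NoAxisymMinimalBlowupDatum := by
  intro ν hν u₀ g hmin hax
  obtain ⟨hL3, hrep, hdiv, -, hnot⟩ := hmin
  exact hnot (h ν hν u₀ g hL3 hrep hdiv hax)

/-- W1 already closes the route together with the two other items: the deciding theorem uses the
crux only through W1.  (Same proof term as the route's `closes`, with `h₃` replaced.) -/
theorem closes_of_noAxisymMinimalBlowupDatum (h₂ : MinimalDatumPFold) (h₄ : PFoldToAxisymmetric)
    (hW : NoAxisymMinimalBlowupDatum) : NavierStokesRegularity := by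
  show Literature.NS.NavierStokesExistenceSmoothR3
  intro ν hν u₀ hsm hdiv hdec
  by_contra hno
  obtain ⟨u₁, g, hmin, hax⟩ := h₄ ν hν (h₂ ν hν ⟨u₀, hsm, hdiv, hdec, hno⟩)
  exact hW ν hν u₁ g hmin hax

/-- Conversely, given the two other (open/proved) items, the summit statement gives W1 back only
through the vacuity of the Clay-failure antecedent — recorded here to make precise that W1 is
summit-equivalent RELATIVE TO `MinimalDatumPFold ∧ PFoldToAxisymmetric` exactly as the crux is
(cf. `stub_minimalDatumPFoldIffSummitOfAXH` in Theorems): if Clay (A) holds at every `ν`, no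
minimal blow-up datum of the CLAY-generated kind is ever produced, but `IsMinimalBlowupDatum`
itself is not thereby empty (ρ_max^pure may be attained by non-Clay L³ data), so `S → W1` is NOT
provable by logic alone.  We only record the trivial direction used by the census. -/
theorem crux_route_uses_only_W1 :
    (MinimalDatumPFold → PFoldToAxisymmetric → NoAxisymMinimalBlowupDatum → NavierStokesRegularity) ∧
    (AxisymmetricKatoGlobal → NoAxisymMinimalBlowupDatum) :=
  ⟨closes_of_noAxisymMinimalBlowupDatum, noAxisymMinimalBlowupDatum_of_crux⟩

end Summit.NavierStokesRegularity.NavierStokesRegularity.Cruxes.AxisymmetricKatoGlobal.StrategistS20g19
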